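import Literature.MathematicalPhysics.QuantumFieldTheory.BalabanImbrieJaffe1984to88.BIJ88SmoothFactors5133

/-!
# `BalabanImbrieJaffe1984to88.BIJ88CubeProductFDeriv306` — T. Bałaban, J. Imbrie, A. Jaffe, *Effective action and cluster properties of
the abelian Higgs model*, Commun. Math. Phys. **114** (1988) 257–315 [BalabanImbrieJaffe1988]: pp. 304–306 [PDF 48–50] (Sect. 5.13) —
**A FIELD DERIVATIVE OF THE CUBE PRODUCT LANDS ON ONE CUBE**.  Print, p. 305: *"integration by parts replaces Φ by C_s(δ/δΦ) + C_s f
… We integrate by parts all fields appearing in this formula. Each Φ contracts through a C_s to another Φ, to an f(□_i)_s or to ℱ."*,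
with (p. 304) *"f(□_i) is the product of all the factors under the dμ … integral above that are localized in □_i … Our construction of the
□_i ensures no overlap of factors between different □_i's"*: in the random-walk form (5.13.3) every `δ/δΦ(x)` produced by a train acts on the
product `Π_{□_i⊂X} f(□_i)` of CUBE-LOCAL factors, and therefore — Leibniz plus locality — on the single factor `f(□_{i(x)})` of the cube
containing the site `x` (this is what makes the expansion a walk through cubes, p. 306 (5.13.3): *"⟨δ/δΦ, C_s □_{i₁} Δ □_{i₂} C_s □_{i₃} ⋯⟩"*).
THIS FILE PROVES that calculus step for p13's observable `BIJ88PolymerRep5134Gauss.obs blk f X` (the cube product on the fields of the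
region `X`, the object the trains of `BIJ88WalkFormIntegrated5133` act on).

statement-level skeleton of published theorems with citation tags; proofs where landed; nothing here is a claim about the Yang–Mills mass gap

PDF held: `paper:balaban1988-cmp114-bij-abelian-higgs-effective-action` (journal page = PDF page + 256); pages re-read this session as text:
PDF 48 (p. 304) L30–33, PDF 49 (p. 305) L40–43.

CITATION HEADER (lean-in-tree rule).  Part of the lit-balaban TYPED SKELETON (HOME `run/shared/lean/pub/lit-balaban/`), Phase 2, seat p36
(gen 20, unit `lit-balaban-p36`); rows C2.Eq5.13.3-5.13.4 (member: calculus of the cube product the trains act on) and **C2.Eq5.14.3-5.14.4**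
(§f brick 4: with `f := fD (uD …)`, `BIJ88SlotFactorsSmooth308`/`BIJ88SlotFactorsShell309`/`BIJ88WalkFormLocated309`, the site derivative of
the located cube product is the derivative of ONE located slot product, zero off that χ-slot's shell) of `HOME/lit-balaban-r16/ROWS-C2-part2.md`.
WHAT IS REPRODUCED (theorem-only; no definitions, no `Prop` facts; axioms standard): `fderiv_apply_eq_zero_of_local` (a cube-local
differentiable factor has zero derivative along every field direction vanishing on its cube — the line `s ↦ φ + s·w` is constant),
**`hasFDerivAt_obs`** (Leibniz: `D(Π_{i∈X} f(□_i)) = Σ_{i∈X} (Π_{j≠i} f(□_j)) · Df(□_i) ∘ ext_X`, Mathlib's `HasFDerivAt.finsetProd` through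
p13's `extCLM`), `ext_single`, **`fderiv_obs_single`** (`∂_q Π_{□_i⊂X} f(□_i) = (Π_{j ≠ blk q} f(□_j)) · ∂_q f(□_{blk q})` for cube-local
differentiable factors), `fderiv_obs_single_eq_zero`.
HONEST SCOPE.  Calculus of the cube product only (first order, and — v1.1 §2 — the second-order vertex); no estimate here; the located
instance (factors `fD (uD …)`, slot-level Leibniz inside a cube, shell factors) is the successor's §f proper.

(v1.1, p36 gen 20: §2 APPENDED — `local_fderiv_apply` (locality is inherited by `ψ ↦ ∂_w G(ψ)`), `hasFDerivAt_prod_ext` /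
`fderiv_prod_ext_single` (Leibniz and site derivative of a SUB-product `Π_{j∈Y} f(□_j)`), **`D2_obs`**: the second-order vertex
`∂_p∂_q Π_{□_i⊂X} f(□_i)` (p13's `BIJ88TrainPieces306.D2 (obs blk f X) φ p q` by `rfl`) for `C²` cube-local factors JOINS TWO CUBES
(`blk p ≠ blk q`: `(Π_{j≠blk p, blk q} f(□_j))·∂_p f(□_{blk p})·∂_q f(□_{blk q})`) OR STAYS IN ONE (`blk p = blk q = i`:
`(Π_{j≠i} f(□_j))·∂_p∂_q f(□_i)`) — the vertex `□_{i₁} Δ □_{i₂}` of (5.13.3) read on the cube product; v1 declarations byte-identical.)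
-/

namespace Literature.MathematicalPhysics.QuantumFieldTheory.BalabanImbrieJaffe1984to88.BIJ88CubeProductFDeriv306

open Finset
open scoped BigOperators
open BIJ88PolymerRep5134Gauss (obs)
open BIJ88SmoothFactors5133 (extCLM extCLM_apply)

variable {α I : Type} [Fintype α] (blk : α → I) (f : I → (α → ℝ) → ℝ)

/-- **LOCALITY KILLS CROSS DERIVATIVES**: a cube-local factor (`f(□_i)` sees only the field in `□_i`) has zero derivative in every field
direction vanishing on `□_i`. [cite: BalabanImbrieJaffe1988, §5.13 p.305] -/
theorem fderiv_apply_eq_zero_of_local {i : I} (hloc : ∀ φ ψ : α → ℝ, (∀ x, blk x = i → φ x = ψ x) → f i φ = f i ψ)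
    {φ : α → ℝ} (hd : DifferentiableAt ℝ (f i) φ) {w : α → ℝ} (hw : ∀ x, blk x = i → w x = 0) :
    fderiv ℝ (f i) φ w = 0 := by
  have hline : HasDerivAt (fun s : ℝ => φ + s • w) w 0 := by
    simpa using ((hasDerivAt_id (0 : ℝ)).smul_const w).const_add φ
  have hcomp : HasDerivAt (fun s : ℝ => f i (φ + s • w)) (fderiv ℝ (f i) φ w) 0 := by
    have h : HasFDerivAt (f i) (fderiv ℝ (f i) φ) (φ + (0 : ℝ) • w) := by
      rw [zero_smul, add_zero]; exact hd.hasFDerivAt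
    exact h.comp_hasDerivAt (0 : ℝ) hline
  have hconst : HasDerivAt (fun s : ℝ => f i (φ + s • w)) 0 0 := by
    have heq : (fun s : ℝ => f i (φ + s • w)) = fun _ => f i φ := funext fun s =>
      hloc _ _ fun x hx => by simp [hw x hx]
    rw [heq]; exact hasDerivAt_const 0 _
  exact hcomp.unique hconst


variable [DecidableEq α] [DecidableEq I]

omit [DecidableEq α] in
/-- **LEIBNIZ FOR THE CUBE PRODUCT**: if every factor `f(□_i)`, `□_i ⊂ X`, is differentiable at the (extended) field, the observable
`Π_{□_i⊂X} f(□_i)` on the fields of `X` has derivative `Σ_{i∈X} (Π_{j≠i} f(□_j)) · Df(□_i) ∘ ext` (p. 305: *"integration by parts replaces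
Φ by C_s(δ/δΦ) + C_s f … Each Φ contracts through a C_s to another Φ, to an f(□_i)_s or to ℱ"* — the δ/δΦ acting on the product of the
cube factors). [cite: BalabanImbrieJaffe1988, §5.13 p.305] -/
theorem hasFDerivAt_obs (X : Finset I) (φ : BIJ88PolymerRep5134Gauss.Site blk X → ℝ)
    (hf : ∀ i ∈ X, DifferentiableAt ℝ (f i) (BIJ88PolymerRep5134Gauss.ext blk X φ)) :
    HasFDerivAt (obs blk f X)
      (∑ i ∈ X, (∏ j ∈ X.erase i, f j (BIJ88PolymerRep5134Gauss.ext blk X φ)) •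
        ((fderiv ℝ (f i) (BIJ88PolymerRep5134Gauss.ext blk X φ)).comp (extCLM blk X))) φ := by
  have hfac : ∀ i ∈ X, HasFDerivAt (fun ψ : BIJ88PolymerRep5134Gauss.Site blk X → ℝ => f i (BIJ88PolymerRep5134Gauss.ext blk X ψ))
      ((fderiv ℝ (f i) (BIJ88PolymerRep5134Gauss.ext blk X φ)).comp (extCLM blk X)) φ := fun i hi => by
    have h1 : HasFDerivAt (f i) (fderiv ℝ (f i) (BIJ88PolymerRep5134Gauss.ext blk X φ)) (extCLM blk X φ) := by
      rw [extCLM_apply]; exact (hf i hi).hasFDerivAt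
    have h2 := h1.comp φ (extCLM blk X).hasFDerivAt
    refine h2.congr_of_eventuallyEq (Filter.Eventually.of_forall fun ψ => ?_)
    simp [Function.comp, extCLM_apply]
  have h := HasFDerivAt.finsetProd hfac
  refine (h.congr_of_eventuallyEq (Filter.Eventually.of_forall fun ψ => ?_)).congr_fderiv ?_
  · simp [obs]
  · rfl

omit [Fintype α] in
/-- the extension by zero of the unit field at a site `q` of `X` is the unit field at `q`. [cite: BalabanImbrieJaffe1988, §5.13 p.306] -/
theorem ext_single (X : Finset I) (q : BIJ88PolymerRep5134Gauss.Site blk X) :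
    BIJ88PolymerRep5134Gauss.ext blk X (Pi.single q 1) = Pi.single q.1 1 := by
  funext x
  by_cases hq : x = q.1
  · subst hq
    simp [BIJ88PolymerRep5134Gauss.ext, q.2]
  · have hne : ∀ h : blk x ∈ X, (⟨x, h⟩ : BIJ88PolymerRep5134Gauss.Site blk X) ≠ q := fun h hc => hq (congrArg Subtype.val hc)
    rw [Pi.single_eq_of_ne hq]
    show (if h : blk x ∈ X then (Pi.single q (1 : ℝ) : BIJ88PolymerRep5134Gauss.Site blk X → ℝ) ⟨x, h⟩ else 0) = 0
    by_cases h : blk x ∈ X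
    · rw [dif_pos h, Pi.single_eq_of_ne (hne h)]
    · rw [dif_neg h]

/-- **A FIELD DERIVATIVE AT A SITE LANDS ON THAT SITE'S CUBE** (cube-local, differentiable factors): `∂_q Π_{□_i⊂X} f(□_i) =
(Π_{j ≠ blk q} f(□_j)) · ∂_q f(□_{blk q})` — the step of the p. 305/306 random walk in which *"Each Φ contracts through a C_s to … an
f(□_i)_s"* visits exactly the cube containing the contracted site. [cite: BalabanImbrieJaffe1988, §5.13 p.306] -/
theorem fderiv_obs_single (X : Finset I) (φ : BIJ88PolymerRep5134Gauss.Site blk X → ℝ)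
    (hf : ∀ i ∈ X, DifferentiableAt ℝ (f i) (BIJ88PolymerRep5134Gauss.ext blk X φ))
    (hloc : ∀ i ∈ X, ∀ φ ψ : α → ℝ, (∀ x, blk x = i → φ x = ψ x) → f i φ = f i ψ) (q : BIJ88PolymerRep5134Gauss.Site blk X) :
    fderiv ℝ (obs blk f X) φ (Pi.single q 1) =
      (∏ j ∈ X.erase (blk q.1), f j (BIJ88PolymerRep5134Gauss.ext blk X φ)) *
        fderiv ℝ (f (blk q.1)) (BIJ88PolymerRep5134Gauss.ext blk X φ) (Pi.single q.1 1) := by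
  rw [(hasFDerivAt_obs blk f X φ hf).fderiv]
  simp only [_root_.sum_apply, _root_.smul_apply, ContinuousLinearMap.comp_apply, extCLM_apply, ext_single, smul_eq_mul]
  refine Finset.sum_eq_single (blk q.1) (fun i hi hne => ?_) (fun h => absurd q.2 h)
  rw [fderiv_apply_eq_zero_of_local blk f (hloc i hi) (hf i hi) (fun x hx => ?_), mul_zero]
  rw [Pi.single_apply, if_neg]
  rintro rfl
  exact hne hx.symm

/-- in particular the derivative of the cube product at a site VANISHES when that site's cube factor has zero derivative there (e.g. a
located χ-slot off its shell, `BIJ88SlotFactorsShell309`). [cite: BalabanImbrieJaffe1988, §5.13 p.306] -/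
theorem fderiv_obs_single_eq_zero (X : Finset I) (φ : BIJ88PolymerRep5134Gauss.Site blk X → ℝ)
    (hf : ∀ i ∈ X, DifferentiableAt ℝ (f i) (BIJ88PolymerRep5134Gauss.ext blk X φ))
    (hloc : ∀ i ∈ X, ∀ φ ψ : α → ℝ, (∀ x, blk x = i → φ x = ψ x) → f i φ = f i ψ) (q : BIJ88PolymerRep5134Gauss.Site blk X)
    (hq : fderiv ℝ (f (blk q.1)) (BIJ88PolymerRep5134Gauss.ext blk X φ) (Pi.single q.1 1) = 0) : fderiv ℝ (obs blk f X) φ (Pi.single q 1) = 0 := by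
  rw [fderiv_obs_single blk f X φ hf hloc q, hq, mul_zero]

/-! ## §2 Second order: the vertex `∂_p∂_q` of a train joins two cubes or stays in one -/

omit [DecidableEq α] in
/-- **locality is inherited by derivatives**: for a cube-local, differentiable `G` (local to `□_i`), `ψ ↦ ∂_w G(ψ)` is again local to `□_i`.
[cite: BalabanImbrieJaffe1988, §5.13 p.306] -/
theorem local_fderiv_apply {i : I} {G : (α → ℝ) → ℝ} (hloc : ∀ φ ψ : α → ℝ, (∀ x, blk x = i → φ x = ψ x) → G φ = G ψ)
    (hd : Differentiable ℝ G) (w : α → ℝ) (φ ψ : α → ℝ) (h : ∀ x, blk x = i → φ x = ψ x) :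
    fderiv ℝ G φ w = fderiv ℝ G ψ w := by
  let P : (α → ℝ) →L[ℝ] (α → ℝ) := ContinuousLinearMap.pi fun x => if blk x = i then ContinuousLinearMap.proj (R := ℝ) x else 0
  have hPapp : ∀ (χ' : α → ℝ) x, P χ' x = if blk x = i then χ' x else 0 := fun χ' x => by
    simp only [P, ContinuousLinearMap.pi_apply]; split_ifs <;> rfl
  have hP : ∀ χ', G (P χ') = G χ' := fun χ' => hloc _ _ fun x hx => by rw [hPapp, if_pos hx]
  have hcomp : G = G ∘ P := funext fun χ' => (hP χ').symm
  have hPeq : P φ = P ψ := funext fun x => by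
    rw [hPapp, hPapp]; split_ifs with hx
    · exact h x hx
    · rfl
  have key : ∀ χ', fderiv ℝ G χ' w = fderiv ℝ G (P χ') (P w) := fun χ' => by
    conv_lhs => rw [hcomp]
    rw [fderiv_comp χ' (hd _) P.differentiableAt, P.fderiv, ContinuousLinearMap.comp_apply]
  rw [key φ, key ψ, hPeq]

omit [DecidableEq α] in
/-- Leibniz for a sub-product `Π_{j∈Y} f(□_j)` of the cube factors seen through the fields of `X`. [cite: BalabanImbrieJaffe1988, §5.13 p.306] -/
theorem hasFDerivAt_prod_ext (X Y : Finset I) (φ : BIJ88PolymerRep5134Gauss.Site blk X → ℝ)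
    (hf : ∀ i ∈ Y, DifferentiableAt ℝ (f i) (BIJ88PolymerRep5134Gauss.ext blk X φ)) :
    HasFDerivAt (fun ψ : BIJ88PolymerRep5134Gauss.Site blk X → ℝ => ∏ j ∈ Y, f j (BIJ88PolymerRep5134Gauss.ext blk X ψ))
      (∑ i ∈ Y, (∏ j ∈ Y.erase i, f j (BIJ88PolymerRep5134Gauss.ext blk X φ)) •
        ((fderiv ℝ (f i) (BIJ88PolymerRep5134Gauss.ext blk X φ)).comp (extCLM blk X))) φ := by
  have hfac : ∀ i ∈ Y, HasFDerivAt (fun ψ : BIJ88PolymerRep5134Gauss.Site blk X → ℝ => f i (BIJ88PolymerRep5134Gauss.ext blk X ψ))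
      ((fderiv ℝ (f i) (BIJ88PolymerRep5134Gauss.ext blk X φ)).comp (extCLM blk X)) φ := fun i hi => by
    have h1 : HasFDerivAt (f i) (fderiv ℝ (f i) (BIJ88PolymerRep5134Gauss.ext blk X φ)) (extCLM blk X φ) := by
      rw [extCLM_apply]; exact (hf i hi).hasFDerivAt
    have h2 := h1.comp φ (extCLM blk X).hasFDerivAt
    refine h2.congr_of_eventuallyEq (Filter.Eventually.of_forall fun ψ => ?_)
    simp [Function.comp, extCLM_apply]
  have h := HasFDerivAt.finsetProd hfac
  exact (h.congr_of_eventuallyEq (Filter.Eventually.of_forall fun ψ => by simp)).congr_fderiv rfl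

/-- the site derivative of a sub-product: lands on the cube of the site if that cube is in the sub-product, else vanishes.
[cite: BalabanImbrieJaffe1988, §5.13 p.306] -/
theorem fderiv_prod_ext_single (X Y : Finset I) (φ : BIJ88PolymerRep5134Gauss.Site blk X → ℝ)
    (hf : ∀ i ∈ Y, DifferentiableAt ℝ (f i) (BIJ88PolymerRep5134Gauss.ext blk X φ))
    (hloc : ∀ i ∈ Y, ∀ φ ψ : α → ℝ, (∀ x, blk x = i → φ x = ψ x) → f i φ = f i ψ) (q : BIJ88PolymerRep5134Gauss.Site blk X) :
    fderiv ℝ (fun ψ : BIJ88PolymerRep5134Gauss.Site blk X → ℝ => ∏ j ∈ Y, f j (BIJ88PolymerRep5134Gauss.ext blk X ψ)) φ (Pi.single q 1) =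
      if blk q.1 ∈ Y then (∏ j ∈ Y.erase (blk q.1), f j (BIJ88PolymerRep5134Gauss.ext blk X φ)) *
        fderiv ℝ (f (blk q.1)) (BIJ88PolymerRep5134Gauss.ext blk X φ) (Pi.single q.1 1) else 0 := by
  rw [(hasFDerivAt_prod_ext blk f X Y φ hf).fderiv]
  simp only [_root_.sum_apply, _root_.smul_apply, ContinuousLinearMap.comp_apply, extCLM_apply, ext_single, smul_eq_mul]
  have hzero : ∀ i ∈ Y, i ≠ blk q.1 → (∏ j ∈ Y.erase i, f j (BIJ88PolymerRep5134Gauss.ext blk X φ)) *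
      fderiv ℝ (f i) (BIJ88PolymerRep5134Gauss.ext blk X φ) (Pi.single q.1 1) = 0 := fun i hi hne => by
    rw [fderiv_apply_eq_zero_of_local blk f (hloc i hi) (hf i hi) (fun x hx => ?_), mul_zero]
    rw [Pi.single_apply, if_neg]
    rintro rfl
    exact hne hx.symm
  split_ifs with hq
  · exact Finset.sum_eq_single (blk q.1) (fun i hi hne => hzero i hi hne) (fun h => absurd hq h)
  · exact Finset.sum_eq_zero fun i hi => hzero i hi (fun h => hq (h ▸ hi))

/-- **THE SECOND-ORDER VERTEX `∂_p∂_q Π_{□_i⊂X} f(□_i)` JOINS TWO CUBES OR STAYS IN ONE** (`C²` cube-local factors): if `blk p ≠ blk q` it is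
`(Π_{j ≠ blk p, blk q} f(□_j)) · ∂_p f(□_{blk p}) · ∂_q f(□_{blk q})`; if `blk p = blk q = i` it is `(Π_{j≠i} f(□_j)) · ∂_p∂_q f(□_i)` — the
vertex `□_{i₁} Δ □_{i₂}` of the walk (5.13.3) (p. 306) read on the cube product; the left side is p13's `BIJ88TrainPieces306.D2 (obs blk f X) φ p q`
by `rfl`. [cite: BalabanImbrieJaffe1988, §5.13 Eq. (5.13.3) p.306] -/
theorem D2_obs (X : Finset I) (hf2 : ∀ i ∈ X, ContDiff ℝ 2 (f i))
    (hloc : ∀ i ∈ X, ∀ φ ψ : α → ℝ, (∀ x, blk x = i → φ x = ψ x) → f i φ = f i ψ)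
    (φ : BIJ88PolymerRep5134Gauss.Site blk X → ℝ) (p q : BIJ88PolymerRep5134Gauss.Site blk X) :
    fderiv ℝ (fun ψ => fderiv ℝ (obs blk f X) ψ (Pi.single q 1)) φ (Pi.single p 1) =
      if blk p.1 = blk q.1 then
        (∏ j ∈ X.erase (blk q.1), f j (BIJ88PolymerRep5134Gauss.ext blk X φ)) *
          fderiv ℝ (fun ψ' => fderiv ℝ (f (blk q.1)) ψ' (Pi.single q.1 1)) (BIJ88PolymerRep5134Gauss.ext blk X φ) (Pi.single p.1 1)
      else
        (∏ j ∈ (X.erase (blk q.1)).erase (blk p.1), f j (BIJ88PolymerRep5134Gauss.ext blk X φ)) *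
          fderiv ℝ (f (blk p.1)) (BIJ88PolymerRep5134Gauss.ext blk X φ) (Pi.single p.1 1) *
          fderiv ℝ (f (blk q.1)) (BIJ88PolymerRep5134Gauss.ext blk X φ) (Pi.single q.1 1) := by
  have hd : ∀ i ∈ X, Differentiable ℝ (f i) := fun i hi => (hf2 i hi).differentiable (by norm_num)
  have hd' : ∀ i ∈ X, Differentiable ℝ (fun ψ : α → ℝ => fderiv ℝ (f i) ψ (Pi.single q.1 1)) := fun i hi =>
    (((hf2 i hi).fderiv_right (m := 1) le_rfl).clm_apply contDiff_const).differentiable (by norm_num)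
  -- the first derivative as a function of the field
  have h1 : (fun ψ : BIJ88PolymerRep5134Gauss.Site blk X → ℝ => fderiv ℝ (obs blk f X) ψ (Pi.single q 1)) =
      fun ψ => (∏ j ∈ X.erase (blk q.1), f j (BIJ88PolymerRep5134Gauss.ext blk X ψ)) *
        fderiv ℝ (f (blk q.1)) (BIJ88PolymerRep5134Gauss.ext blk X ψ) (Pi.single q.1 1) :=
    funext fun ψ => fderiv_obs_single blk f X ψ (fun i hi => (hd i hi) _) hloc q
  -- the factor ψ ↦ ∂_q f_{blk q}(ext ψ) and its derivative along e_p
  set g : (α → ℝ) → ℝ := fun ψ' => fderiv ℝ (f (blk q.1)) ψ' (Pi.single q.1 1) with hg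
  have hgd : Differentiable ℝ g := hd' _ q.2
  have hG : HasFDerivAt (fun ψ : BIJ88PolymerRep5134Gauss.Site blk X → ℝ => g (BIJ88PolymerRep5134Gauss.ext blk X ψ))
      ((fderiv ℝ g (BIJ88PolymerRep5134Gauss.ext blk X φ)).comp (extCLM blk X)) φ := by
    have h1' : HasFDerivAt g (fderiv ℝ g (BIJ88PolymerRep5134Gauss.ext blk X φ)) (extCLM blk X φ) := by
      rw [extCLM_apply]; exact (hgd _).hasFDerivAt
    refine (h1'.comp φ (extCLM blk X).hasFDerivAt).congr_of_eventuallyEq (Filter.Eventually.of_forall fun ψ => ?_)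
    simp [Function.comp, extCLM_apply]
  have hPr := hasFDerivAt_prod_ext blk f X (X.erase (blk q.1)) φ (fun i hi => (hd i (Finset.mem_of_mem_erase hi)) _)
  have hprod := hPr.fun_mul hG
  rw [h1, hprod.fderiv]
  -- evaluate the derivative of the product at e_p
  rw [_root_.add_apply, _root_.smul_apply, _root_.smul_apply, ContinuousLinearMap.comp_apply, extCLM_apply,
    ext_single, smul_eq_mul, smul_eq_mul, ← hPr.fderiv,
    fderiv_prod_ext_single blk f X (X.erase (blk q.1)) φ (fun i hi => (hd i (Finset.mem_of_mem_erase hi)) _)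
      (fun i hi => hloc i (Finset.mem_of_mem_erase hi)) p]
  by_cases hpq : blk p.1 = blk q.1
  · -- same cube: the sub-product misses `blk p`, its derivative vanishes
    rw [if_pos hpq, if_neg (by rw [hpq]; exact Finset.notMem_erase _ _), mul_zero, add_zero]
  · -- two cubes: the mixed second derivative of `f(□_{blk q})` along `e_p` vanishes by locality of `g`
    rw [if_neg hpq, if_pos (Finset.mem_erase.2 ⟨hpq, p.2⟩)]
    have hg0 : fderiv ℝ g (BIJ88PolymerRep5134Gauss.ext blk X φ) (Pi.single p.1 1) = 0 :=
      fderiv_apply_eq_zero_of_local blk (fun _ : I => g) (i := blk q.1)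
        (local_fderiv_apply blk (hloc _ q.2) (hd _ q.2) (Pi.single q.1 1)) (hgd _) fun x hx => by
          rw [Pi.single_apply, if_neg]; rintro rfl; exact hpq hx
    rw [hg0, mul_zero, zero_add, hg]
    ring

end Literature.MathematicalPhysics.QuantumFieldTheory.BalabanImbrieJaffe1984to88.BIJ88CubeProductFDeriv306
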